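import Summits.KontsevichZagierPeriods.KontsevichZagierPeriods.Theses.GaussManinCertificates

/-!
# KontsevichZagierPeriods / GaussManinCertificates — the assembly `Assembly` (stmt-KontsevichZagierPeriods-3016)

Route `KontsevichZagierPeriods/GaussManinCertificates` (families first — band Newton–Leibniz
generates semialgebraic Stokes, Gauss–Manin rigidity supplies rational certificates), item
stmt-KontsevichZagierPeriods-3016 (`Assembly`, rank 1):

  `KZStokes → StokesFormKernel → KontsevichZagierPeriods`.

Pure algebra in the free abelian group `KZ.FormalRep`:
* `KZStokes` says every semialgebraic Stokes generator `[ρ]` (bounded domain, `ℚ`-semialgebraic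
  fibrewise primitive `H` continuous on the closed vertical fibres, vanishing on their frontiers,
  with fibrewise derivative the integrand) already lies in `KZ.relations`; hence the subgroup they
  generate is `≤ KZ.relations` (`AddSubgroup.closure_le`) and
  `KZ.relations ⊔ closure(Stokes) ≤ KZ.relations` (`sup_le`).
* `StokesFormKernel` (Conjecture 1, Stokes reading) puts every formal combination with value `0`
  into `KZ.relations ⊔ closure(Stokes)`; applied to `c = [r] − [r']` for two rational
  representations of equal value (`KZ.eval c = value r − value r' = 0` by `KZ.eval_of`) it gives
  `[r] − [r'] ∈ KZ.relations`, i.e. `KZ.Equivalent r r'`, which is the summit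
  `KontsevichZagierPeriods = Literature.Periods.KZPeriodConjecture`.

The two antecedents are NOT discharged here: the theorem is the implication, nothing more (the
same term as the route's deciding theorem `closes`, restated against the item's own `def`). No
definitions, no named facts; unconditional.

References: M. Kontsevich, D. Zagier, *Periods* (2001), §1.2 (rules 1–3, Conjecture 1);
A. Huber, S. Müller-Stach, *Periods and Nori Motives* (2017), §13.1.
-/

namespace Summit.KontsevichZagierPeriods.GaussManinCertificates.Assembly

open Summit.KontsevichZagierPeriods.KontsevichZagierPeriods.Theses.GaussManinCertificates

/-- **`Assembly`** (settles stmt-KontsevichZagierPeriods-3016, route GaussManinCertificates):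
`KZStokes → StokesFormKernel → KontsevichZagierPeriods`.
Proof: for rational `r, r'` with `value r = value r'`, `KZ.eval ([r] − [r']) = 0` (`KZ.eval_of`),
so `StokesFormKernel` gives `[r] − [r'] ∈ KZ.relations ⊔ closure(Stokes generators)`; by
`KZStokes` every Stokes generator is in `KZ.relations`, so that sup is `≤ KZ.relations`
(`AddSubgroup.closure_le`, `sup_le`), whence `KZ.Equivalent r r'`.
[Kontsevich–Zagier 2001, §1.2] -/
theorem assembly_proof :
    Summit.KontsevichZagierPeriods.KontsevichZagierPeriods.Theses.GaussManinCertificates.Assembly := by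
  unfold Summit.KontsevichZagierPeriods.KontsevichZagierPeriods.Theses.GaussManinCertificates.Assembly
  intro h₁ h₂ n m r r' _ _ hv
  have h0 : Literature.NumberTheory.Transcendental.KZ.eval
      (Literature.NumberTheory.Transcendental.KZ.of r -
        Literature.NumberTheory.Transcendental.KZ.of r') = 0 := by
    simp [Literature.NumberTheory.Transcendental.KZ.eval_of, hv]
  have hmem := h₂ _ h0
  refine (sup_le le_rfl ((AddSubgroup.closure_le _).mpr ?_)) hmem
  rintro d ⟨k, ρ, H, hb, hsa, hcont, hfr, hder, rfl⟩
  exact h₁ k ρ H hb hsa hcont hfr hder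

end Summit.KontsevichZagierPeriods.GaussManinCertificates.Assembly
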